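import Mathlib.Analysis.SpecialFunctions.Pow.Real
import Literature.MathematicalPhysics.StatisticalMechanics.BarlowCoordination
import Literature.Geometry.DiscreteGeometry.HexagonalSpiral
import HarnessLib

/-!
# Arithmetic and label-adjacency helpers for the word-uniform `∛243` surface rung

Route `StickyWulffConstant` of the venture `Summits/Ventures/Crystal3D` (cell `crystal3d-full`),
support toward the crux `StackingLiminf` (item stmt-Ventures-19145).  Three small lemmas used by
`StickyWulffConstantStackingLiminfUniformBound.lean` (the bound
`numContacts ≤ 6N − ∛243·N^{2/3} + 1` on every Barlow stacking):

* `cbrt243_rpow_sub_one_le` — the AM-GM endgame: for `N ≥ 0`, `M ≥ 1`, `t ≥ 0`, `t² = 12M − 3`,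
  `∛243·N^{2/3} − 1 ≤ Nt/M + 3M` (with `a = Nt/M`, `b = 3M+1`: `27a²b ≥ 972N²` and
  `4(a+b)³ − 27a²b = (a − 2b)²(4a + b) ≥ 0`);
* `mem_sixOffsets_iff_adj` — in-layer neighbour offsets of the Barlow coordinates
  (`BarlowCoordination.sixOffsets`) are exactly triangular-lattice adjacency of the labels
  (`HarborthSpiral.Adj`, the vocabulary of the on-lattice Harborth bound);
* `adjCount_eq_sum` — `HarborthSpiral.adjCount` unfolded as a fibrewise sum.

WHAT THIS IS NOT: any statement about packings; pure bookkeeping.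
-/

noncomputable section

namespace Summit.Ventures.Crystal3D.Theorems

open Finset
open Literature.MathematicalPhysics.StatisticalMechanics (sixOffsets mem_sixOffsets_iff)
open Literature.Geometry.DiscreteGeometry.HarborthSpiral (Adj adjCount normForm)

/-- The arithmetic endgame of the layer decomposition: for reals `N ≥ 0`, `M ≥ 1` and
`t ≥ 0` with `t² = 12M − 3`, `∛243 · N^{2/3} − 1 ≤ N t / M + 3M`.  (With `a = Nt/M`, `b = 3M + 1`:
`27a²b ≥ 972N²` and `4(a+b)³ − 27a²b = (a − 2b)²(4a + b) ≥ 0`.) -/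
theorem cbrt243_rpow_sub_one_le {N M t : ℝ} (hM : 1 ≤ M) (hN : 0 ≤ N) (ht : 0 ≤ t)
    (ht2 : t ^ 2 = 12 * M - 3) :
    (243 : ℝ) ^ ((1 : ℝ) / 3) * N ^ ((2 : ℝ) / 3) - 1 ≤ N * t / M + 3 * M := by
  have hM0 : 0 < M := by linarith
  set a : ℝ := N * t / M with ha
  set b : ℝ := 3 * M + 1 with hb
  have ha0 : 0 ≤ a := by positivity
  have hb0 : 0 ≤ b := by positivity
  have haM : a * M = N * t := by rw [ha]; field_simp
  have h27 : 972 * N ^ 2 ≤ 27 * a ^ 2 * b := by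
    have hM2 : 0 < M ^ 2 := by positivity
    have key : 27 * a ^ 2 * b * M ^ 2 = 27 * N ^ 2 * ((12 * M - 3) * (3 * M + 1)) := by
      have : a ^ 2 * M ^ 2 = N ^ 2 * t ^ 2 := by rw [← mul_pow, haM, mul_pow]
      calc 27 * a ^ 2 * b * M ^ 2 = 27 * (a ^ 2 * M ^ 2) * b := by ring
        _ = 27 * (N ^ 2 * t ^ 2) * b := by rw [this]
        _ = 27 * N ^ 2 * ((12 * M - 3) * (3 * M + 1)) := by rw [ht2, hb]; ring
    have hpoly : 36 * M ^ 2 ≤ (12 * M - 3) * (3 * M + 1) := by nlinarith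
    have hN2 : 0 ≤ N ^ 2 := by positivity
    have h1 : 972 * N ^ 2 * M ^ 2 ≤ 27 * a ^ 2 * b * M ^ 2 := by
      rw [key]; nlinarith [mul_le_mul_of_nonneg_left hpoly hN2]
    exact le_of_mul_le_mul_right h1 hM2
  have hcube : 243 * N ^ 2 ≤ (a + b) ^ 3 := by
    have key : 4 * (a + b) ^ 3 = 27 * a ^ 2 * b + (a - 2 * b) ^ 2 * (4 * a + b) := by ring
    have hsos : 0 ≤ (a - 2 * b) ^ 2 * (4 * a + b) := by positivity
    nlinarith
  have hab : 0 ≤ a + b := by positivity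
  have h3 : ((a + b) ^ 3) ^ ((1 : ℝ) / 3) = a + b := by
    rw [show ((1 : ℝ) / 3) = ((3 : ℕ) : ℝ)⁻¹ by norm_num]
    exact Real.pow_rpow_inv_natCast hab (by norm_num)
  have hroot : (243 * N ^ 2 : ℝ) ^ ((1 : ℝ) / 3) ≤ a + b := by
    rw [← h3]
    exact Real.rpow_le_rpow (by positivity) hcube (by norm_num)
  have hsplit : (243 * N ^ 2 : ℝ) ^ ((1 : ℝ) / 3) =
      (243 : ℝ) ^ ((1 : ℝ) / 3) * N ^ ((2 : ℝ) / 3) := by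
    rw [Real.mul_rpow (by norm_num) (by positivity)]
    congr 1
    rw [show ((2 : ℝ) / 3) = 2 * ((1 : ℝ) / 3) by norm_num, Real.rpow_mul hN]
    congr 1
    exact_mod_cast (Real.rpow_natCast N 2).symm
  have : a + b = N * t / M + 3 * M + 1 := by rw [ha, hb]; ring
  linarith [hroot, hsplit]

/-- In-layer adjacency in Barlow coordinates is triangular-lattice adjacency of the labels:
`(a − a', b − b') ∈ sixOffsets ↔ Adj (a, b) (a', b')`. -/
theorem mem_sixOffsets_iff_adj (a b a' b' : ℤ) :
    (a - a', b - b') ∈ sixOffsets ↔ Adj (a, b) (a', b') := by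
  rw [mem_sixOffsets_iff, Adj, normForm]
  simp only [Prod.mk_sub_mk]
  constructor <;> intro h <;> nlinarith [h]

/-- The ordered adjacency count of a finite label set, fibrewise: `adjCount S` is the number of
ordered pairs `(q, r) ∈ S × S` with `Adj q r`, written as a sum over the first label. -/
theorem adjCount_eq_sum (S : Finset (ℤ × ℤ)) :
    adjCount S = ∑ q ∈ S, (S.filter (Adj q)).card := rfl

end Summit.Ventures.Crystal3D.Theorems

end
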